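import Summits.BirchSwinnertonDyer.Rank1Residual.Partition.MainConjecturesIrreducibleBDPCor54
import Summits.BirchSwinnertonDyer.Rank1Residual.Partition.MainConjecturesIrreducibleIdentityRows
import HarnessLib

/-!
# Rows C16, C3 of the partition FROM PUBLISHED NAMED FACTS with NO Tamagawa proviso, the `p = 3`
# two-sided anticyclotomic link RE-KEYED from the arXiv-v2-worded input `h412` (Yan–Zhu Thm. 4.12 ∘
# CGLS 5.1.3, A198; (Im)-integral clause PRE-dependent in the refereed text) to the PUBLISHED
# re-sourcing `hYZ54 : YanZhu2026.cor54_prop342_thm513_generator_constantCoeff` (Yan–Zhu J. Algebra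
# 693 (2026) Cor. 5.4 ∘ Prop. 3.14 ∘ CGS Math. Ann. 393 (2025) Prop. 3.4.2 ∘ CGLS 2022 Thm. 5.1.3, A320)

HONEST FRAMING (cell `b2b-bsdres`, run/shared/lean/b2b/bsd-rank1-residual/, verbatim in every
file): the goal of the cell is to DELETE the COMBINATION-SHAPED residual classes of the
Birch–Swinnerton-Dyer formula for ALL analytic-rank `≤ 1` elliptic curves over `ℚ` — "full BSD
formula for every rank `≤ 1` curve in class `C`" assembled STRICTLY from published theorems — so
that the rank-`≤ 1` remainder becomes exactly the CONSTRUCTION-SHAPED classes, which are TYPED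
(missing-input `Prop`s), NOT attempted. This is not "finishing BSD". Research routes; no claim
beyond the stated classes; nothing booked; no label changes. THEOREMS ONLY (no definition, no named
fact, no `sorry`); every published theorem enters as one of the tree's existing named Literature
facts BY NAME; every unproved / untyped-in-Literature statement enters as an EXPLICIT binder.
Unit `b2b-bsdres-lit-glue` (GLUE seat), gen 13, sized ask A21 of `HOME/b2b-bsdres-lit-glue/GLUE.md`
§G12.2 — leaf 1/4: a row layer over `MainConjecturesIrreducibleBDPCor54.lean` (the `h54`-adapters,
p362171) mirroring gen 9's `MainConjecturesIrreducibleIdentityRows.lean`.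

## Why (one paragraph, common to the four `…Cor54` leaves of GLUE gen 13)

The gen-9/10 records bind `h412 : thm412_thm513_generator_constantCoeff` — Yan–Zhu's BDP main
conjecture "integral under (Im)" AS WORDED IN arXiv v2 (Thm. 4.12). In the refereed text (arXiv v4 =
J. Algebra 693 (2026)) that clause is Thm. 5.7 under FULL `p`-adic image of `G_K`, the (Im) weakening
being Remark 5.10 "via [BSTW, Prop. 12.7]" (a preprint), so every consumer of `h412` is CONDITIONAL
ON A PREPRINT until re-keyed (cell rulings R2-131.8; R2-133.1: "consumers SHOULD re-key to cor54
where its three binders are standing hypotheses"). The refereed text proves its own rank-one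
`p`-part (Thm. 5.11) "from the integral part of Corollary 5.4, [CGS, Proposition 3.4.2], the fact
that `𝓛_p^Gr(E/K)⁺(1) = 𝓛_p^Gr(E/K)⁻(1) ≠ 0`, and the descent arguments in [JSW]" (v4 TeX l.1347);
that chain minus the descent is the Literature fact `YanZhu2026.cor54_prop342_thm513_generator_constantCoeff`
(gen 12, p358701, registry A320), whose three extra binders (`rank_ℤ E(K) = 1`, `#Ш(E/K)[p^∞] < ∞`,
`P_K` of infinite order) are in scope at every consumer. `h412` is CONSUMED only inside the `p = 3`
anticyclotomic link `X11b.imcWaldspurgerOnTreeGoodAt_inducedPlace_of_thm412_of_thm331`, whose twin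
`…_of_cor54_of_thm331` landed in `MainConjecturesIrreducibleBDPCor54.lean` (p362171); everything
above it only THREADS the binder. The re-keyed leaves re-thread, theorem for theorem, with the binder
`(hYZ54 : cor54_prop342_thm513_generator_constantCoeff)` in `h412`'s positional slot — named `hYZ54`,
not `h54`, because in the numbered records `h54` is CGLS display (5.4) ∘ 5.1.3
(`display54_thm513_generator_constantCoeff`). The gen-9/10 theorems stay (kernel-valid conditionals
on `h412`); no statement of any landed file is edited; no definition, no new named fact.

## Contents (each the `hYZ54`-twin of the gen-9 theorem of the same name, `h412 ↦ hYZ54`)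

* §1 `X11b.indexIdentityAt_of_heegner_of_cor54_of_thm331` — the Heegner-index identity over `K` at a
  classical datum, `p = 3`, from published named facts (datum level);
* §2 `RowC16.bsdp_of_publishedFacts_of_identityLink_of_cor54`,
  `RowC3.bsdp_of_publishedFacts_of_kobayashiMainConjecture_of_identityLink_of_cor54` — the row
  theorems with NO Tamagawa binder (row C2 has no `p = 3` pair and keeps gen 9's theorem).

References: [YanZhu2026] Thm. 5.2 (= arXiv v2 Thm. 4.9), Cor. 5.4, Prop. 3.14, Thm. 5.11 and its
proof (arXiv:2412.20078v4 TeX l.1166–1184, l.896–903, l.1345–1347); [CastellaGrossiSkinner2025]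
Prop. 3.4.2; [CastellaGrossiLeeSkinner2022] Thm. 5.1.3; [JetchevSkinnerWan2017] Thm. 1.2.1, Thm. 3.3.1;
[BurungaleCastellaSkinner2025] Thm. 1.1.2 (b), Thm. 1.2.4 (b); the module docstrings of
`MainConjecturesIrreducibleBDPCor54.lean` and `MainConjecturesIrreducibleIdentityRows.lean`;
HOME/b2b-bsdres-lit-glue/GLUE.md GEN 12 §G12.2, GEN 13.
-/

set_option autoImplicit false

noncomputable section

open scoped Classical

open WeierstrassCurve NumberField IsDedekindDomain Literature.NumberTheory.EllipticCurves
  Literature.NumberTheory.EllipticCurves.ModularForms Literature.NumberTheory.Automorphic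
  Literature.NumberTheory.EllipticCurves.Rank1Residual
  Literature.NumberTheory.EllipticCurves.YanZhu2026
  Literature.NumberTheory.EllipticCurves.BurungaleCastellaSkinner2025
  Literature.NumberTheory.EllipticCurves.BurungaleKobayashiOta2024
  Literature.NumberTheory.EllipticCurves.CastellaGrossiLeeSkinner2022
  Literature.NumberTheory.EllipticCurves.JetchevSkinnerWan2017
  Summit.BirchSwinnertonDyer.BirchSwinnertonDyer.Theorems.Rank1ResidualX1Defs

namespace Summit.BirchSwinnertonDyer.Rank1Residual

/-! ### §1 The Heegner-index identity over `K` at a datum, `p = 3`, on `hYZ54` -/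

namespace X11b

section Datum

variable (W : WeierstrassCurve ℚ) [W.IsElliptic] [W.IsGloballyMinimal] (p : ℕ) [Fact p.Prime]
  (N : ℕ) [NeZero N] (K : Type) [Field K] [NumberField K]
  (Dt : ModularParametrizationData W N) (H : HeegnerDatum N (NumberField.discr K)) (ιC : K →+* ℂ)
  (P : (W.baseChange K).toAffine.Point)

/-- **The `p`-part of BSD for `E/K` in Gross–Zagier's shape at `p = 3` — the Heegner-index identity
`2·ord_3 ∏_ℓ c_ℓ(E) + ord_3 #Ш(E/K) = 2·ord_3 [E(K):ℤP_K]` (`X11b.IndexIdentityAt`) — FROM PUBLISHED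
NAMED FACTS, with NO hypothesis on the Tamagawa numbers**, at every classical Manin-unit Heegner datum
of a pair `(E, 3)` with `ord_{s=1} L(E,s) = 1`, `3` good ordinary, `ρ̄_{E,3}` surjective (hence (Im)
at `3` by Wuthrich 2014 Lemma 20, `hW20`): the TWO-SIDED anticyclotomic link from the re-sourced
published fact `hYZ54` (Yan–Zhu 2026 Cor. 5.4 ∘ Prop. 3.14 ∘ CGS 2025 Prop. 3.4.2 ∘ CGLS 5.1.3 — the
printed proof of Yan–Zhu Thm. 5.11 minus the descent) + JSW 2017 Thm. 3.3.1 (`h331`) through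
`imcWaldspurgerOnTreeGoodAt_inducedPlace_of_cor54_of_thm331`, control from JSW 3.3.1
(`controlOnTreeGoodAt_of_thm331_of_inducedPlace`), gen 3's bookkeeping
`indexIdentityAt_of_onTreeGoodLinks_of_allSplit`; rank one and finiteness over `K` by GZK + descent
and Kolyvagin (`hKo`) — which also supply `hYZ54`'s three rank-one binders; `P_K` non-torsion by
Gross–Zagier (`hGZ`); (irred_𝒦) by `irrK_of_surj`. The `hYZ54`-twin of gen 9's
`indexIdentityAt_of_heegner_of_thm412_of_thm331`.
[cite: YanZhu2026, Cor. 5.4, Prop. 3.14 and the proof of Thm. 5.11 (arXiv:2412.20078v4 TeX l.1166–1184, l.1347)]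
[cite: CastellaGrossiSkinner2025, Prop. 3.4.2] [cite: CastellaGrossiLeeSkinner2022, Thm. 5.1.3]
[cite: JetchevSkinnerWan2017, Thm. 3.3.1 with §3.5 (3.5.d), §7.3.1 (eq:tamK)]
[cite: Castella2018, §5 (5.3) (arXiv:1704.06608 p. 12)] [cite: Wuthrich2014, Lemma 20 (p. 399)]
[cite: GrossLMS1991, §2 Conj. (2.2)] [cite: Kolyvagin1990, Thm. A] -/
theorem indexIdentityAt_of_heegner_of_cor54_of_thm331
    (hYZ54 : cor54_prop342_thm513_generator_constantCoeff) (h331 : thm331_anticyclotomicControl)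
    (hW20 : Wuthrich2014.lemma20_surjective_threeAdic_of_semistable)
    (hGZ : gross_zagier N W K) (hKo : kolyvagin N W K) (hmod : hasEntireLFunction_rat)
    (hGZK : rank_eq_analyticRank_of_analyticRank_le_one)
    (hp : p = 3) (hord : GoodOrd W p) (hsurj : Surj W p) (hr : W.analyticRank = 1)
    (hN : W.conductorNorm ℤ = N) (hK : IsImaginaryQuadratic K) (hodd : Odd (NumberField.discr K))
    (h3 : NumberField.discr K ≠ -3) (hHN : SatisfiesHeegnerHypothesis N K)
    (hHp : SatisfiesHeegnerHypothesis p K)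
    (hLt : (W.quadraticTwist (NumberField.discr K : ℚ)).entireLFunction 1 ≠ 0)
    (hP : WeierstrassCurve.Affine.Point.map ιC.toRatAlgHom P = heegnerPointComplex Dt H)
    (hc : ¬ (p : ℤ) ∣ Dt.c) : IndexIdentityAt W p K P := by
  subst hp
  haveI : Finite (W.baseChange K).sha :=
    finite_sha_baseChange_of_heegner W N K Dt H ιC P hGZ hKo hmod hr hK hHN hLt hP
  obtain ⟨hrQ, hShaQ⟩ := hGZK W hr.le
  rw [hr] at hrQ
  obtain ⟨hrk, hfinp⟩ :=
    mordellWeilRank_baseChange_eq_one_and_finite_sha_of_twist_L_one_ne_zero hGZK W K hK 3 hrQ hShaQ hLt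
  have hPinf : ¬ IsOfFinAddOrder P :=
    not_isOfFinAddOrder_of_heegner_of_analyticRank_eq_one W N K Dt H ιC P hGZ hmod hr hK hHN hLt hP
  have hirrK : (W.baseChange K).HasIrreducibleModPGaloisRep 3 := irrK_of_surj W 3 hsurj K hK.1
  have him : BigIm W 3 := X9.bigIm_three_of_surj W hW20 (Or.inl hord.1) hsurj
  obtain ⟨κ, γ, 𝔭, hκ, hγ, h𝔭⟩ := exists_anticyclotomic_generator_prime (p := 3) hK
  haveI : Fact (κ.IsTopGenerator γ) := ⟨hγ⟩
  have hsplit : SplitsIn K 3 := hHp 3 Fact.out (dvd_refl 3)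
  obtain ⟨he, hf⟩ := degreeOne_of_splitsIn hK.1 hsplit h𝔭
  set ι : K →+* ℚ_[3] := embAt K 3 𝔭 h𝔭 he hf with hι
  have hCTL : ControlOnTreeGoodAt 3 κ (inducedPlace ι) γ ι P :=
    controlOnTreeGoodAt_of_thm331_of_inducedPlace h331 le_rfl hord.1 hK hHp hN hHN hirrK ι κ hκ γ hrk
      hfinp P hPinf
  have hIW : IMCWaldspurgerOnTreeGoodAt 3 κ (inducedPlace ι) γ ι P :=
    imcWaldspurgerOnTreeGoodAt_inducedPlace_of_cor54_of_thm331 hYZ54 h331 le_rfl hord him hK hodd h3 hN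
      hHN hHp hirrK ι κ hκ γ Dt hc H ιC P hP hrk hfinp hPinf
  exact indexIdentityAt_of_onTreeGoodLinks_of_allSplit hK hN hHN hIW hCTL

end Datum

end X11b

/-! ### §2 Rows C16 and C3 with NO Tamagawa binder, the `p = 3` link on `hYZ54` -/

section Rows

variable (W : WeierstrassCurve ℚ) [W.IsElliptic] [W.IsGloballyMinimal] (p : ℕ) [Fact p.Prime]

/-- **Row C16 (`r ≤ 1`: `p = 3` good ordinary, (irr), surj(3) ∨ ram(3)) FROM PUBLISHED NAMED FACTS,
the ONLY non-fact binders being the row predicate and `r_an ≤ 1`** — gen 9's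
`RowC16.bsdp_of_publishedFacts_of_identityLink` with `h412 ↦ hYZ54`. Rank `0`: Yan–Zhu Thm. 5.2
(= v2 Thm. 4.9, `hYZ`; `RowC16.bsdp_rankZero_of_yzThm49`). Rank `1`: the identity form
(`bsdp_rankOne_of_thm331_of_columnMainConjecture_odd_of_identityLink`) with the column MC = `hYZ`,
(Im) at `3` ⇐ surj (Wuthrich L. 20 `hW20`), ram(3) ⇒ surj(3) (`surj_of_irr_of_ram`), (irred_𝒦) ⇐
(sur), and the TWO-SIDED anticyclotomic link from the re-sourced PUBLISHED fact `hYZ54` (Yan–Zhu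
2026 Cor. 5.4 ∘ Prop. 3.14 ∘ CGS Prop. 3.4.2 ∘ CGLS 5.1.3) + JSW 3.3.1
(`X11b.imcWaldspurgerOnTreeGoodAt_inducedPlace_of_cor54_of_thm331`). This is the printed proof of
Yan–Zhu 2026 Thm. 5.11 at `p = 3` ("in the rank one case … from the integral part of Corollary 5.4,
[CGS, Proposition 3.4.2], the fact that `𝓛_p^Gr(E/K)⁺(1) = 𝓛_p^Gr(E/K)⁻(1) ≠ 0`, and the descent
arguments in [JSW]", v4 TeX l.1345–1347), kernel-checked at statement level on the row's WHOLE locus.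
[cite: YanZhu2026, Thm. 5.2, Cor. 5.4, Thm. 5.11 and its proof (arXiv:2412.20078v4 TeX l.1345–1347)]
[cite: CastellaGrossiSkinner2025, Prop. 3.4.2] [cite: CastellaGrossiLeeSkinner2022, Thm. 5.1.3]
[cite: JetchevSkinnerWan2017, Thm. 3.3.1] [cite: Wuthrich2014, Lemma 20 (p. 399)] [cite: Miller2011LMS, Def. 1.1] -/
theorem RowC16.bsdp_of_publishedFacts_of_identityLink_of_cor54
    (hGZ : ∀ (N : ℕ) [NeZero N] (W : WeierstrassCurve ℚ) (K : Type) [Field K] [NumberField K],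
      gross_zagier N W K)
    (hKo : ∀ (N : ℕ) [NeZero N] (W : WeierstrassCurve ℚ) (K : Type) [Field K] [NumberField K],
      kolyvagin N W K)
    (hYZ : thm49_charIdeal_eq_padicLFunction_integral)
    (hW20 : Wuthrich2014.lemma20_surjective_threeAdic_of_semistable)
    (h331 : thm331_anticyclotomicControl) (hYZ54 : cor54_prop342_thm513_generator_constantCoeff)
    (hGr : greenberg_charValue_rankZero) (hGZK : rank_eq_analyticRank_of_analyticRank_le_one)
    (hmod : hasEntireLFunction_rat) (hpar : nonempty_modularParametrizationData)
    (hnf : exists_isNewformOf) (hHL : HoffsteinLuo1997_exists_twist_L_one_ne_zero)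
    (hMaz : mazur_not_dvd_maninConstant_of_odd) (hNS : integral_neronScaling_of_isGloballyMinimal)
    (h : RowC16 W p) (hr : W.analyticRank ≤ 1) :
    BSDp W p := by
  rcases Nat.lt_or_ge W.analyticRank 1 with h0 | h1
  · exact RowC16.bsdp_rankZero_of_yzThm49 hYZ hW20 hGr hpar hGZK h (by omega)
  · have hr1 : W.analyticRank = 1 := le_antisymm hr h1
    obtain ⟨hp3, hord, hirr, hsr⟩ := h
    have hsurj : Surj W p := hsr.elim id fun hram ↦ surj_of_irr_of_ram W p hirr hram
    subst hp3
    have him3 : ∀ (V : WeierstrassCurve ℚ) [V.IsElliptic] [V.IsGloballyMinimal],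
        GoodOrd V 3 → Surj V 3 → BigIm V 3 :=
      fun V _ _ hordV hsV ↦ X9.bigIm_three_of_surj V hW20 (Or.inl hordV.1) hsV
    refine bsdp_rankOne_of_thm331_of_columnMainConjecture_odd_of_identityLink hGZ hKo h331 hGr hGZK
      hmod hpar hnf hHL hMaz hNS W 3 le_rfl hord hsurj hr1
      (fun V _ _ hordV hirrV himV ↦ hYZ V 3 le_rfl hordV hirrV himV) him3
      (fun K _ _ hK _ _ ↦ irrK_of_surj W 3 hsurj K hK.1) ?_
    intro N _ K _ _ Dt H ιC P hN hK hodd hlt hHN hHp _ hP hc hirrK hrk hfinp hPinf κ hκ γ _ ι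
    exact X11b.imcWaldspurgerOnTreeGoodAt_inducedPlace_of_cor54_of_thm331 hYZ54 h331 le_rfl hord
      (him3 W hord hsurj) hK hodd (by omega) hN hHN hHp hirrK ι κ hκ γ Dt hc H ιC P hP hrk hfinp hPinf

/-- **Row C3 (= JSW 2017 Thm. 1.2.1) at every prime of the row, the whole ORDINARY branch FROM
PUBLISHED NAMED FACTS with NO Tamagawa proviso** — gen 9's
`RowC3.bsdp_of_publishedFacts_of_kobayashiMainConjecture_of_identityLink` with `h412 ↦ hYZ54`.
Ordinary (`p ∤ a_p`): the identity form with the column MC = BCS Thm. 1.1.2 (b) (`p ≥ 5`) / Yan–Zhu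
Thm. 5.2 (= v2 4.9, `p = 3`), (sur) from Diamond's refined Serre (`RowC3.surj`), (im) ⇐ surj
(`X9.bigIm_of_surj` / Wuthrich L. 20), (irred_𝒦) ⇐ (sur), and the TWO-SIDED link from BCS 1.2.4 (b) ∘
CGLS 5.1.3 (`h124`, `p > 3`) / the re-sourced PUBLISHED fact `hYZ54` (Yan–Zhu 2026 Cor. 5.4 ∘ Prop.
3.14 ∘ CGS Prop. 3.4.2 ∘ CGLS 5.1.3, `p = 3`) + JSW 3.3.1. Supersingular (`p ∣ a_p`) unchanged: the
typed Kobayashi signed main conjecture (`hKMC`, OPEN in print off CM / `a_p = 0`) + BKO 2024 Cor. A.5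
(`hA5`).
[cite: JetchevSkinnerWan2017, Thm. 1.2.1, Thm. 3.3.1, §7.4] [cite: BurungaleCastellaSkinner2025, Thm. 1.1.2 (b), Thm. 1.2.4 (b)]
[cite: YanZhu2026, Thm. 5.2, Cor. 5.4, proof of Thm. 5.11 (arXiv:2412.20078v4 TeX l.1347)]
[cite: CastellaGrossiSkinner2025, Prop. 3.4.2] [cite: CastellaGrossiLeeSkinner2022, Thm. 5.1.3]
[cite: BurungaleKobayashiOta2023, App. A Cor. A.5] [cite: Wuthrich2014, Lemma 20 (p. 399)] [cite: Miller2011LMS, Def. 1.1] -/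
theorem RowC3.bsdp_of_publishedFacts_of_kobayashiMainConjecture_of_identityLink_of_cor54
    (hGZ : ∀ (N : ℕ) [NeZero N] (W : WeierstrassCurve ℚ) (K : Type) [Field K] [NumberField K],
      gross_zagier N W K)
    (hKo : ∀ (N : ℕ) [NeZero N] (W : WeierstrassCurve ℚ) (K : Type) [Field K] [NumberField K],
      kolyvagin N W K)
    (hBCS : thm112b_charIdeal_eq_padicLFunction_integral)
    (hYZ : thm49_charIdeal_eq_padicLFunction_integral)
    (hW20 : Wuthrich2014.lemma20_surjective_threeAdic_of_semistable)
    (h331 : thm331_anticyclotomicControl) (h124 : thm124b_thm513_generator_constantCoeff)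
    (hYZ54 : cor54_prop342_thm513_generator_constantCoeff)
    (hA5 : corA5_pPart_of_signedCharIdeal_eq)
    (hGr : greenberg_charValue_rankZero) (hGZK : rank_eq_analyticRank_of_analyticRank_le_one)
    (hmod : hasEntireLFunction_rat) (hpar : nonempty_modularParametrizationData)
    (hnf : exists_isNewformOf) (hLL : diamond1995_refinedSerre)
    (hHL : HoffsteinLuo1997_exists_twist_L_one_ne_zero)
    (hMaz : mazur_not_dvd_maninConstant_of_odd) (hNS : integral_neronScaling_of_isGloballyMinimal)
    (h : RowC3 W p)
    (ε : ℤˣ) (hKMC : (p : ℤ) ∣ W.frobeniusTrace p → Supersingular.KobayashiMainConjecture W p ε) :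
    BSDp W p := by
  by_cases hdvd : (p : ℤ) ∣ W.frobeniusTrace p
  · -- supersingular: typed Kobayashi MC (one sign) + BKO Cor. A.5
    exact RowC3.bsdp_rankOne_ss_of_kobayashiMainConjecture_of_corA5 hA5 hmod hGZK h hdvd ε (hKMC hdvd)
  · -- ordinary (anomalous allowed): everything published, NO Tamagawa proviso
    have hord : GoodOrd W p := ⟨h.2.2.1, hdvd⟩
    have hp : 5 ≤ p ∨ p = 3 ∧ (GoodOrd W p ∨ W.frobeniusTrace 3 = 0) := h.2.2.2.2
    have hp3 : 3 ≤ p := by rcases hp with h5 | ⟨h3, -⟩ <;> omega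
    have hsurj : Surj W p := RowC3.surj hnf hLL h
    have hIm : ∀ (V : WeierstrassCurve ℚ) [V.IsElliptic] [V.IsGloballyMinimal],
        GoodOrd V p → Surj V p → BigIm V p := by
      intro V _ _ hordV hsV
      by_cases h5 : 5 ≤ p
      · exact X9.bigIm_of_surj V p h5 hsV
      · have h3 : p = 3 := by rcases hp with h | ⟨h, -⟩ <;> omega
        subst h3
        exact X9.bigIm_three_of_surj V hW20 (Or.inl hordV.1) hsV
    refine bsdp_rankOne_of_thm331_of_columnMainConjecture_odd_of_identityLink hGZ hKo h331 hGr hGZK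
      hmod hpar hnf hHL hMaz hNS W p hp3 hord hsurj h.1 ?_ hIm
      (fun K _ _ hK _ _ ↦ irrK_of_surj W p hsurj K hK.1) ?_
    · intro V _ _ hordV hirrV himV
      by_cases h5 : 5 ≤ p
      · exact hBCS V p (by omega) hordV hirrV himV
      · have h3 : p = 3 := by rcases hp with h | ⟨h, -⟩ <;> omega
        subst h3
        exact hYZ V 3 le_rfl hordV hirrV himV
    · intro N _ K _ _ Dt H ιC P hN hK hodd hlt hHN hHp _ hP hc hirrK hrk hfinp hPinf κ hκ γ _ ι
      by_cases h5 : 3 < p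
      · exact X11b.imcWaldspurgerOnTreeGoodAt_inducedPlace_of_thm124b_of_thm331 h124 h331 h5 hord hsurj
          hK hodd (by omega) hN hHN hHp hirrK ι κ hκ γ Dt hc H ιC P hP hrk hfinp hPinf
      · have h3 : p = 3 := by rcases hp with h | ⟨h, -⟩ <;> omega
        subst h3
        exact X11b.imcWaldspurgerOnTreeGoodAt_inducedPlace_of_cor54_of_thm331 hYZ54 h331 le_rfl hord
          (hIm W hord hsurj) hK hodd (by omega) hN hHN hHp hirrK ι κ hκ γ Dt hc H ιC P hP hrk hfinp
          hPinf

end Rows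

end Summit.BirchSwinnertonDyer.Rank1Residual

end
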